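import Summits.BirchSwinnertonDyer.BirchSwinnertonDyer.Theorems.PrintCf2SplitBadTwoKummerBranchFrame
import HarnessLib

/-!
# Crux `PrintCf2.SplitBadTwoRankOneOfFacts` (stmt-BirchSwinnertonDyer-20368), road α v10.3 — S3c (R-BV) factor (F1), piece (B):
# AT `v̄` THE `W*`-COMPONENT DETECTS LOCAL VANISHING OF KUMMER CLASSES: `loc_{v̄}(e_* x) = 0 ⟺ loc_{v̄} x = 0` on `res_⊤(range κ)`

Cell `bsd-print-cf2`, width seat `bsd-line-cf2-p1-w6` g3 (prover-bsd-line-cf2-p1-w6-g3-0). `--supports stmt-BirchSwinnertonDyer-20368`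
(helper, Theses-free). HONEST FRAMING: nothing here closes the crux or a registered stub; BSD is not proved by any of this; no summit
statement is proved by this seat. No definition, no named fact, no `sorry`.

WHAT. The displayed factor (F1) `v₂ #(Q_M ⊓ ker loc_{v̄}) = ℓ + e₁([d]₂)` of (R-BV) (LEAD cut 13) counts the classes `k • e_* res_⊤ κ_N(P_K)` of the
PINNED summand `W* = E[𝔮_r^∞]` (pinned at `v`) that die on `D_{v̄}`. THIS FILE removes the projector from that local condition: on the S3c frame,
for every global Kummer class `x ∈ Q = res_⊤(range κ) ≤ H¹(⊤, E[2^∞])`,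
  **`loc_{v̄} x = 0` in `H¹(⊤ ⊓ D_{v̄}, E[2^∞])` ⟺ `loc_{v̄}(e_* x) = 0` in `H¹(⊤ ⊓ D_{v̄}, W*)`,**
GRANTED the local cyclicity (T-loc at `v̄`) «the `2`-torsion of `loc_{v̄}(Q)` is cyclic» and the finiteness `Finite 𝔖_{v̄}(K, W*)` that (F1)'s frame
ALREADY carries. MECHANISM = -w3 g9's branch argument WITH THE ROLES SWAPPED `(r, v) ↦ (1 − r, v̄)`: their per-frame (H1′)
`comap_kummer_le_ker_resOfLe_of_frame_of_cyclic` (generic in the root and the place) applied to the root `1 − r` at the place `v̄` says that the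
CONJUGATE components `ι′_*⁻¹ Q` die on `D_{v̄}` as soon as `𝔖_{v̄}(K, E[𝔮_{1−(1−r)}^∞]) = 𝔖_{v̄}(K, W*)` is finite; then
`x = ι_* e_* x + ι′_* e′_* x` (`resH1Hom_subtype_proj_add_eq`), stability (S) `resSubgroup_kummer_stable` (`e′_* x ∈ ι′_*⁻¹ Q`,
`map_proj_conj_le_comap_of_stable`) and naturality of `loc` (`resOfLe_resH1Hom_subtype`, `FineSelmerCoefficientMap.resOfLe_comp_resH1Hom_id`).
* §1 `resOfLe_eq_zero_iff_resOfLe_proj_eq_zero` — GENERIC (`V/K`, `p`, `w`, complementary projectors, a stable `Q` whose conjugate components die at `w`);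
* §2 **`resOfLe_kummer_eq_zero_iff_proj_of_frame`** — the S3c-frame instance at `v̄` ⟸ (T-loc at `v̄`) ∧ `Finite 𝔖_{v̄}(K, W*)`;
  `comap_conj_kummer_le_ker_resOfLe_vbar_of_frame` — the mirror (H1′): `ι′_*⁻¹(res_⊤ range κ) ≤ ker loc_{v̄}`.
presearch: Greenberg LNM 1716 §2 (Kummer image vs. `H¹(K_v, C)`), Agboola 2007 §6 — the printed routes use formal groups; here the component is
decided by finiteness exactly as in p671916 (tree); nothing to cite beyond the tree; no Literature fact filed. beyond-print theorem: no.

References: [GreenbergLNM1716] §2 Prop. 2.1; [Agboola2007] §6 (arXiv p0014:L5); [Rubin1999] §2; [SerreGaloisCohomology1997] I §2.4.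
-/

noncomputable section

open scoped Classical

set_option linter.dupNamespace false
set_option autoImplicit false

open NumberField IsDedekindDomain Field WeierstrassCurve
open Literature.NumberTheory.EllipticCurves Literature.NumberTheory.EllipticCurves.GreenbergSelmer
open Literature.NumberTheory.EllipticCurves.Castella2018.AcSelmer
open Literature.NumberTheory.EllipticCurves.Agboola2007
open Literature.NumberTheory.EllipticCurves.ResKernel
open Literature.NumberTheory.GaloisRepresentations

universe u

namespace Summit.BirchSwinnertonDyer.BirchSwinnertonDyer.Theorems.PrintCf2.RestrictedSelmerPair

open Summit.BirchSwinnertonDyer.BirchSwinnertonDyer.Theorems.PrintCf2.CMPrimes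

/-! ## §1. Generic: a stable subgroup whose conjugate components die at `w` -/

section Generic

variable {K : Type u} [Field K] [NumberField K] (V : WeierstrassCurve K) [V.IsElliptic] (p : ℕ) [Fact p.Prime]
  (π : V.endRing) (r r' : ℤ_[p]) (w : HeightOneSpectrum (𝓞 K))

omit [V.IsElliptic] in
/-- **The `W*`-component detects local vanishing.** Complementary equivariant projectors `e`, `e′` (`ι e + ι′ e′ = id`), a subgroup
`Q ≤ H¹(⊤, E[p^∞])` stable under `ι_* e_*` whose CONJUGATE components `ι′_*⁻¹ Q` die on `⊤ ⊓ D_w`: then for `x ∈ Q`,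
`loc_w x = 0 ⟺ loc_w (e_* x) = 0`. [cite: SerreGaloisCohomology1997, I §2.4] [cite: GreenbergLNM1716, §2] -/
theorem resOfLe_eq_zero_iff_resOfLe_proj_eq_zero
    (e : V.geomPrimaryTorsion p →+ ↥(V.endEigenPrimaryTorsion p π r)) (e' : V.geomPrimaryTorsion p →+ ↥(V.endEigenPrimaryTorsion p π r'))
    (he : ∀ (σ : absoluteGaloisGroup K) (x : V.geomPrimaryTorsion p), e (σ • x) = σ • e x)
    (he' : ∀ (σ : absoluteGaloisGroup K) (x : V.geomPrimaryTorsion p), e' (σ • x) = σ • e' x)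
    (hsum : ∀ x, (e x : V.geomPrimaryTorsion p) + (e' x : V.geomPrimaryTorsion p) = x)
    (Q : AddSubgroup (subgroupH1 (⊤ : Subgroup (absoluteGaloisGroup K)) (V.geomPrimaryTorsion p)))
    (hQstab : ∀ q ∈ Q, resH1Hom (ContinuousMonoidHom.id (⊤ : Subgroup (absoluteGaloisGroup K))) (V.endEigenPrimaryTorsion p π r).subtype (fun _ _ ↦ rfl)
      (resH1Hom (ContinuousMonoidHom.id (⊤ : Subgroup (absoluteGaloisGroup K))) e (fun σ x ↦ he σ x) q) ∈ Q)
    (hdead' : Q.comap (resH1Hom (ContinuousMonoidHom.id (⊤ : Subgroup (absoluteGaloisGroup K))) (V.endEigenPrimaryTorsion p π r').subtype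
        (fun _ _ ↦ rfl)) ≤ (resOfLe ↥(V.endEigenPrimaryTorsion p π r') (inf_le_left : ⊤ ⊓ decomp w ≤ ⊤)).ker)
    {x : subgroupH1 (⊤ : Subgroup (absoluteGaloisGroup K)) (V.geomPrimaryTorsion p)} (hx : x ∈ Q) :
    resOfLe (V.geomPrimaryTorsion p) (inf_le_left : ⊤ ⊓ decomp w ≤ ⊤) x = 0 ↔
      resOfLe ↥(V.endEigenPrimaryTorsion p π r) (inf_le_left : ⊤ ⊓ decomp w ≤ ⊤)
        (resH1Hom (ContinuousMonoidHom.id (⊤ : Subgroup (absoluteGaloisGroup K))) e (fun σ x ↦ he σ x) x) = 0 := by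
  -- naturality `loc_w ∘ e_* = e_* ∘ loc_w`
  have hnat := congrArg (fun f ↦ f x) (FineSelmerCoefficientMap.resOfLe_comp_resH1Hom_id
    (inf_le_left : ⊤ ⊓ decomp w ≤ (⊤ : Subgroup (absoluteGaloisGroup K))) e (fun σ x ↦ he σ x) (fun σ x ↦ he σ x))
  simp only [AddMonoidHom.comp_apply] at hnat
  constructor
  · intro h
    rw [hnat, h, map_zero]
  · intro h
    -- the conjugate component dies at `w`
    have hmem' : resH1Hom (ContinuousMonoidHom.id (⊤ : Subgroup (absoluteGaloisGroup K))) e' (fun σ x ↦ he' σ x) x ∈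
        Q.comap (resH1Hom (ContinuousMonoidHom.id (⊤ : Subgroup (absoluteGaloisGroup K))) (V.endEigenPrimaryTorsion p π r').subtype
          (fun _ _ ↦ rfl)) :=
      map_proj_conj_le_comap_of_stable V p π r r' e e' he he' hsum Q hQstab (AddSubgroup.mem_map_of_mem _ hx)
    have h' : resOfLe ↥(V.endEigenPrimaryTorsion p π r') (inf_le_left : ⊤ ⊓ decomp w ≤ ⊤)
        (resH1Hom (ContinuousMonoidHom.id (⊤ : Subgroup (absoluteGaloisGroup K))) e' (fun σ x ↦ he' σ x) x) = 0 := hdead' hmem'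
    -- `x = ι_* e_* x + ι′_* e′_* x`, restrict, use naturality for `ι_*`, `ι′_*`
    rw [← resH1Hom_subtype_proj_add_eq V p π r r' ⊤ e e' he he' hsum x, map_add, resOfLe_resH1Hom_subtype V p π r,
      resOfLe_resH1Hom_subtype V p π r', h, h', map_zero, map_zero, add_zero]

end Generic

/-! ## §2. The S3c frame at `v̄` -/

section Frame

variable {K : Type} [Field K] [NumberField K]

/-- **THE MIRROR (H1′) AT `v̄`: the CONJUGATE components of the global Kummer classes die on `D_{v̄}`** — -w3 g9's per-frame (H1′)
(`comap_kummer_le_ker_resOfLe_of_frame_of_cyclic`, generic in the root and the place) at the root `1 − r` and the place `v̄`: its finiteness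
hypothesis is `Finite 𝔖_{v̄}(K, E[𝔮_{1−(1−r)}^∞]) = Finite 𝔖_{v̄}(K, W*)`, which (F1)'s frame carries. ⟸ (T-loc at `v̄`).
[cite: Agboola2007, §6 (arXiv p0014:L5)] [cite: GreenbergLNM1716, §2 Prop. 2.1] -/
theorem comap_conj_kummer_le_ker_resOfLe_vbar_of_frame {d : ℤ} (hd0 : d ≠ 0) (W : WeierstrassCurve ℚ) [W.IsElliptic]
    (C : WeierstrassCurve.VariableChange ℚ) (hCW : C • W = cm7.quadraticTwist (d : ℚ)) (hK : IsImaginaryQuadratic K)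
    (vbar : HeightOneSpectrum (𝓞 K)) (π : (W.baseChange K).endRing) (hrel : (π : AddMonoid.End (W.baseChange K).geomPoints) * π = π - 2)
    {r : ℤ_[2]} (hr : r * r = r - 2) (P : W.toAffine.Point) (hP : ¬ IsOfFinAddOrder P)
    (hcyc : ∀ x ∈ ((((W.baseChange K).kummerMapPInfty 2 (W.baseChange K).zsmul_geomPoints_surjective_holds).range).map
        (resSubgroup ⊤ ((W.baseChange K).geomPrimaryTorsion 2))).map
          (resOfLe ((W.baseChange K).geomPrimaryTorsion 2) (inf_le_left : ⊤ ⊓ decomp vbar ≤ ⊤)),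
      ∀ y ∈ ((((W.baseChange K).kummerMapPInfty 2 (W.baseChange K).zsmul_geomPoints_surjective_holds).range).map
        (resSubgroup ⊤ ((W.baseChange K).geomPrimaryTorsion 2))).map
          (resOfLe ((W.baseChange K).geomPrimaryTorsion 2) (inf_le_left : ⊤ ⊓ decomp vbar ≤ ⊤)),
      2 • x = 0 → 2 • y = 0 → x ≠ 0 → ∃ m : ℤ, y = m • x)
    (hfin : Finite (restrictedSelmerBase ↥((W.baseChange K).endEigenPrimaryTorsion 2 π r) 2 vbar)) :
    ((((W.baseChange K).kummerMapPInfty 2 (W.baseChange K).zsmul_geomPoints_surjective_holds).range).map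
        (resSubgroup ⊤ ((W.baseChange K).geomPrimaryTorsion 2))).comap
          (resH1Hom (ContinuousMonoidHom.id (⊤ : Subgroup (absoluteGaloisGroup K)))
            ((W.baseChange K).endEigenPrimaryTorsion 2 π (1 - r)).subtype (fun _ _ ↦ rfl)) ≤
      (resOfLe ↥((W.baseChange K).endEigenPrimaryTorsion 2 π (1 - r)) (inf_le_left : ⊤ ⊓ decomp vbar ≤ ⊤)).ker := by
  have hr' : (1 - r) * (1 - r) = (1 - r) - 2 := by linear_combination hr
  have hsub : (1 : ℤ_[2]) - (1 - r) = r := sub_sub_cancel 1 r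
  have hfin' : Finite (restrictedSelmerBase ↥((W.baseChange K).endEigenPrimaryTorsion 2 π (1 - (1 - r))) 2 vbar) := by
    rw [hsub]; exact hfin
  exact comap_kummer_le_ker_resOfLe_of_frame_of_cyclic hd0 W C hCW hK vbar π hrel hr' P hP hcyc hfin'

/-- **(F1) piece (B): AT `v̄` THE PINNED COMPONENT DETECTS LOCAL VANISHING OF KUMMER CLASSES.** On the S3c frame (member
`C • W = cm7^{(d)}`, imaginary quadratic `K`, `π² = π − 2`, `r² = r − 2`, the ℚ-generator `P`), for complementary equivariant projectors
`e` onto `W* = E[𝔮_r^∞]` and `e′` onto `E[𝔮_{1−r}^∞]` (`ι e + ι′ e′ = id`), GRANTED (T-loc at `v̄`) and `Finite 𝔖_{v̄}(K, W*)`: every global Kummer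
class `x ∈ res_⊤(range κ)` has **`loc_{v̄} x = 0 ⟺ loc_{v̄}(e_* x) = 0`**. (Conjugate components die at `v̄` by the mirror (H1′); stability (S)
is -w3 g9's `resSubgroup_kummer_stable`.) [cite: GreenbergLNM1716, §2 Prop. 2.1] [cite: Agboola2007, §6 (arXiv p0014:L5)] -/
theorem resOfLe_kummer_eq_zero_iff_proj_of_frame {d : ℤ} (hd0 : d ≠ 0) (W : WeierstrassCurve ℚ) [W.IsElliptic]
    (C : WeierstrassCurve.VariableChange ℚ) (hCW : C • W = cm7.quadraticTwist (d : ℚ)) (hK : IsImaginaryQuadratic K)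
    (vbar : HeightOneSpectrum (𝓞 K)) (π : (W.baseChange K).endRing) (hrel : (π : AddMonoid.End (W.baseChange K).geomPoints) * π = π - 2)
    {r : ℤ_[2]} (hr : r * r = r - 2) (P : W.toAffine.Point) (hP : ¬ IsOfFinAddOrder P)
    (e : (W.baseChange K).geomPrimaryTorsion 2 →+ ↥((W.baseChange K).endEigenPrimaryTorsion 2 π r))
    (e' : (W.baseChange K).geomPrimaryTorsion 2 →+ ↥((W.baseChange K).endEigenPrimaryTorsion 2 π (1 - r)))
    (he : ∀ (σ : absoluteGaloisGroup K) (x : (W.baseChange K).geomPrimaryTorsion 2), e (σ • x) = σ • e x)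
    (he' : ∀ (σ : absoluteGaloisGroup K) (x : (W.baseChange K).geomPrimaryTorsion 2), e' (σ • x) = σ • e' x)
    (hsum : ∀ x, (e x : (W.baseChange K).geomPrimaryTorsion 2) + (e' x : (W.baseChange K).geomPrimaryTorsion 2) = x)
    (hcyc : ∀ x ∈ ((((W.baseChange K).kummerMapPInfty 2 (W.baseChange K).zsmul_geomPoints_surjective_holds).range).map
        (resSubgroup ⊤ ((W.baseChange K).geomPrimaryTorsion 2))).map
          (resOfLe ((W.baseChange K).geomPrimaryTorsion 2) (inf_le_left : ⊤ ⊓ decomp vbar ≤ ⊤)),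
      ∀ y ∈ ((((W.baseChange K).kummerMapPInfty 2 (W.baseChange K).zsmul_geomPoints_surjective_holds).range).map
        (resSubgroup ⊤ ((W.baseChange K).geomPrimaryTorsion 2))).map
          (resOfLe ((W.baseChange K).geomPrimaryTorsion 2) (inf_le_left : ⊤ ⊓ decomp vbar ≤ ⊤)),
      2 • x = 0 → 2 • y = 0 → x ≠ 0 → ∃ m : ℤ, y = m • x)
    (hfin : Finite (restrictedSelmerBase ↥((W.baseChange K).endEigenPrimaryTorsion 2 π r) 2 vbar))
    {x : subgroupH1 (⊤ : Subgroup (absoluteGaloisGroup K)) ((W.baseChange K).geomPrimaryTorsion 2)}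
    (hx : x ∈ (((W.baseChange K).kummerMapPInfty 2 (W.baseChange K).zsmul_geomPoints_surjective_holds).range).map
        (resSubgroup ⊤ ((W.baseChange K).geomPrimaryTorsion 2))) :
    resOfLe ((W.baseChange K).geomPrimaryTorsion 2) (inf_le_left : ⊤ ⊓ decomp vbar ≤ ⊤) x = 0 ↔
      resOfLe ↥((W.baseChange K).endEigenPrimaryTorsion 2 π r) (inf_le_left : ⊤ ⊓ decomp vbar ≤ ⊤)
        (resH1Hom (ContinuousMonoidHom.id (⊤ : Subgroup (absoluteGaloisGroup K))) e (fun σ x ↦ he σ x) x) = 0 := by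
  haveI : Fact (Nat.Prime 2) := ⟨Nat.prime_two⟩
  have hunit : IsUnit (r - (1 - r)) := (two_dvd_or_two_dvd_one_sub_of_root hr).2
  exact resOfLe_eq_zero_iff_resOfLe_proj_eq_zero (W.baseChange K) 2 π r (1 - r) vbar e e' he he' hsum _
    (resSubgroup_kummer_stable (W.baseChange K) 2 π r (1 - r) hunit e e' he hsum)
    (comap_conj_kummer_le_ker_resOfLe_vbar_of_frame hd0 W C hCW hK vbar π hrel hr P hP hcyc hfin) hx

end Frame

end Summit.BirchSwinnertonDyer.BirchSwinnertonDyer.Theorems.PrintCf2.RestrictedSelmerPair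

end
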